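import Summits.BirchSwinnertonDyer.BirchSwinnertonDyer.Theorems.EisensteinPrimesX1AnalyticLambdaCertificate
import Summits.BirchSwinnertonDyer.Rank1Residual.X2.GreenbergVatsalAnalyticTransferCore
import HarnessLib

/-!
# Route `EisensteinPrimes`, line `mudescent`, cruxes 3/5: the RELATIVE analytic λ-count — a
# congruence of Σ₀-depleted `p`-adic `L`-functions mod `(p, T^K)` with an `E[p]`-twin transfers
# `μ_an = 0` and `λ_an` (Greenberg–Vatsal's (10) ⟹ Thm. (1.4), analytic half, as a SOCKET; helper)

Seat `bsd-eis-lam-a` g5 (PROGRAMME PART 1b, ACCEL-LIST (4): "ANALYTIC side of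
`stub_lambdaCount_offLocus` … GV §3 (3.9)-type count typed for the off-locus member ⇒ closes the
`AnalyticLambdaEq` conjunct"; items stmt-BirchSwinnertonDyer-19033 / -19035; skeleton owner
bsd-eis-ky, `Lines/mudescent.lean`). THEOREMS ONLY — no definition, no named fact, nothing about any
particular curve; closes nothing; moves no label.

WHAT AND WHY. g0/g2 showed that no ABSOLUTE count of Greenberg–Vatsal type (`λ_an = λ_φ + λ_ψ + Σδ`
or any function of local data) computes `λ_an` at a type-A (`¬GVPar`) étale end (MEMO-2 §4: classes
with equal local profile and `λ_an` differing by 2–4). The one (3.9)-type statement that survives is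
RELATIVE: Greenberg–Vatsal's congruence (10), `L_{Σ₀}(E₁/ℚ,T) ≡ u·L_{Σ₀}(E₂/ℚ,T) (mod pΛ)`,
`u ∈ ℤ_p^×`, for two curves with `E₁[p] ≅ E₂[p]` — whose printed proof (Thm. (1.4), §3; Vatsal
1999) assumes `E[p]` IRREDUCIBLE. Route G of the cell therefore transfers only the ALGEBRAIC `λ`
(`X2/CongruentLambdaShiftMultiplicative`, kernel) and reads `λ_an` BY INSTRUMENT on both curves
(`hlam`, `hlam'` in every `X2/RouteGSplitDisplay*`). This file is the kernel SOCKET for the missing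
analytic statement: it shows, in `Λ = ℤ_p⟦T⟧` and then in the cell's X2 / X1 currencies, that ONE
displayed congruence hypothesis between the depleted integral models — truncated mod `(p, T^K)`, so
that it is a FINITE statement, dischargeable per pair by exact modular-symbol arithmetic and
class-wide by the (unprinted) reducible analogue of GV (10) — transfers `μ_an = 0` and `λ_an`
(shifted by `Σδ(E₂) − Σδ(E₁)`) from the twin to the target:

* §1 (`Λ`-algebra): `hasUnitContent_and_order_eq_of_truncCongr` — if `ḡ₁ ≡ u·ḡ₂ (mod T^K)` in
  `𝔽_p⟦T⟧` (`u ∈ 𝔽_p^×`), `b₂` has unit content and `ord_T ḡ₂ < K`, then `b₁` has unit content and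
  `ord_T ḡ₁ = ord_T ḡ₂`; `…_and_lam_eq_…` (`λ(b₁) = λ(b₂)`); and WITH MULTIPLIERS
  `hasUnitContent_and_lam_add_eq_of_truncCongr_mul`: for unit-content `P₁, P₂` of `T`-orders
  `d₁, d₂`, a truncated congruence `b₁P₁ ≡ u·b₂P₂ (mod p, T^K)` with `λ(b₂) + d₂ < K` gives
  `μ(b₁) = 0` and `λ(b₁) + d₁ = λ(b₂) + d₂` (GV p. 10: "It is then clear that the degrees … coincide").
* §2: the instance `P_i = ∏_{ℓ∈Σ₀} 𝒫_ℓ^{(E_i)}` (`GreenbergVatsal2000.eulerFactorProduct`; orders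
  `Σ_{ℓ∈Σ₀} δ_{E_i}(ℓ)` by `EulerFactorInvariants.order_map_toZMod_eulerFactorProduct`).
  ORIENTATION REMARK (numerical, HOME/lam-a-g5/lam-a-MEMO-5.md §3): GV's `L(E/ℚ,T)` interpolates
  `L(E, χ, 1)` at `χ(γ) − 1` ((3), p. 3) while the tree's `L` interpolates `L(E, χ̄, 1)` there
  (`ratTwistedSymbolSum_mul_plusPeriod`, Birch), so GV's depletion transported to the tree's
  variable is by `P_ℓ(ℓ⁻¹(1+T)^{−f_ℓ})`, the image of `𝒫_ℓ` under `T ↦ (1+T)⁻¹ − 1`; both have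
  unit content and `T`-order `δ_E(ℓ)`, so §1 (stated for arbitrary unit-content multipliers of
  the right orders) serves either orientation; §2 is the literal tree-vocabulary instance.
* §3 X2 ← X2 (both curves odd multiplicative; e.g. the cell's `51a1`-twins):
  `X2.analyticMuLE_zero_and_analyticLambdaEq_of_truncCongr` — data `(f, ϖ, L, G)` at `W`,
  `(f′, ϖ′, L′, G′)` at the twin `W′`, `X2.AnalyticMuLE W′ p 0 ∧ X2.AnalyticLambdaEq W′ p n′`, the
  truncated congruence `G·P ≡ u·G′·P′ (mod p, T^K)`, `n′ + d′ < K`, `n + d = n′ + d′` ⟹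
  `X2.AnalyticMuLE W p 0 ∧ X2.AnalyticLambdaEq W p n` — BOTH analytic inputs of stubs 3 + 4 at `W`.
* §4 X2 ← X1 (route G's shape on row A10: target split multiplicative, twin good anomalous in
  `ClassX1`): the same with the twin read through `X1.MuPart.AnalyticMuLE` /
  `X1.ParitySqueeze.AnalyticLambdaEq` and `L′ = padicLFunction f′ (unitRoot W′ p)`.
* §5 X1 ← X1 (crux 5 currency, row A3).

HONEST FRAMING. The congruence hypothesis is DISPLAYED, not asserted and not a Literature fact: at
reducible `E[p]` it is not a theorem in print (LNP25 = arXiv:2512.00525 §1.2 states the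
multiplicity-one road open; Pollack–Wake 2025 prime level only). Whether it is TRUE at type A is the
object of the seat's pre-registered job «twincong» (HOME/STATUS 2026-08-27 05:2xZ; MEMO-5): the
control there — GV's own irreducible pair `52a1/364a1 @ 5` — satisfies the truncated congruence with
`K = 125`, `Σ₀ = {2, 7, 13}`, both depleted orders `5`, exactly as Thm. (1.4) predicts. Per pair the
hypothesis is no cheaper than g4's resultant certificate at the target; its value is class-wide: if
the reducible (10) is ever proved, route G's `hlam` at the target becomes this file's conclusion.

References: [GreenbergVatsal2000] §1 (3), (8)–(10), Thm. (1.4)–(1.5), §2 Prop. (2.4), §3 p. 42;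
[Washington1997] §7.1; HOME/lam-a-g2/lam-a-MEMO-2.md §4; HOME/lam-a-g5/lam-a-MEMO-5.md.
-/

set_option linter.dupNamespace false
set_option autoImplicit false

noncomputable section

open scoped Classical MatrixGroups ModularForm

open PowerSeries CongruenceSubgroup WeierstrassCurve NumberField IsDedekindDomain
  Literature.NumberTheory.EllipticCurves
  Literature.NumberTheory.EllipticCurves.ModularForms
  Literature.NumberTheory.EllipticCurves.Rank1Residual
  Literature.NumberTheory.EllipticCurves.GreenbergVatsal2000
  Literature.NumberTheory.EllipticCurves.Wuthrich2014
  Summit.BirchSwinnertonDyer.Rank1Residual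
  Summit.BirchSwinnertonDyer.Rank1Residual.X1.MuLambda
  Summit.BirchSwinnertonDyer.Rank1Residual.X11a
  Summit.BirchSwinnertonDyer.Rank1Residual.Iwasawa
  Summit.BirchSwinnertonDyer.Rank1Residual.X2.EulerFactorAlgebra
  Summit.BirchSwinnertonDyer.Rank1Residual.X2.EulerFactorInvariants
  Summit.BirchSwinnertonDyer.Rank1Residual.X2.GreenbergVatsalAnalyticTransferCore
  Summit.BirchSwinnertonDyer.BirchSwinnertonDyer.Theorems

namespace Summit.BirchSwinnertonDyer.BirchSwinnertonDyer.Theorems.EisensteinPrimesAnalyticLambdaCongruenceTransfer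

variable {p : ℕ} [hp : Fact p.Prime]

/-! ## §1. `Λ`-algebra: a truncated congruence mod `(p, T^K)` transfers unit content and `λ` -/

section Algebra

/-- **Truncated congruence ⟹ same `T`-order, unit content.** If the reductions `ḡ₁, ḡ₂ ∈ 𝔽_p⟦T⟧`
of `b₁, b₂ ∈ Λ` satisfy `[T^j]ḡ₁ = u·[T^j]ḡ₂` for all `j < K` with `u ≠ 0`, `b₂` has unit content
and `ord_T ḡ₂ < K`, then `b₁` has unit content and `ord_T ḡ₁ = ord_T ḡ₂`.
[cite: GreenbergVatsal2000, §1 p. 10 (after (10))] [cite: Washington1997, §7.1] -/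
theorem hasUnitContent_and_order_eq_of_truncCongr {b₁ b₂ : IwasawaAlgebra p} {u : ZMod p}
    (hu : u ≠ 0) {K : ℕ}
    (hcong : ∀ j < K, PowerSeries.coeff j (PowerSeries.map (PadicInt.toZMod (p := p)) b₁) =
      u * PowerSeries.coeff j (PowerSeries.map (PadicInt.toZMod (p := p)) b₂))
    (hb₂ : HasUnitContent b₂)
    (hK : (PowerSeries.map (PadicInt.toZMod (p := p)) b₂).order < K) :
    HasUnitContent b₁ ∧
      (PowerSeries.map (PadicInt.toZMod (p := p)) b₁).order =
        (PowerSeries.map (PadicInt.toZMod (p := p)) b₂).order := by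
  set g₁ := PowerSeries.map (PadicInt.toZMod (p := p)) b₁ with hg₁
  set g₂ := PowerSeries.map (PadicInt.toZMod (p := p)) b₂ with hg₂
  have hg₂0 : g₂ ≠ 0 := (hasUnitContent_iff_map_toZMod_ne_zero b₂).mp hb₂
  obtain ⟨m, hm⟩ : ∃ m : ℕ, g₂.order = m :=
    ⟨g₂.order.toNat, (ENat.coe_toNat (fun h => hg₂0 (PowerSeries.order_eq_top.mp h))).symm⟩
  have hmK : m < K := by
    rw [hm] at hK
    exact_mod_cast hK
  obtain ⟨hcm, hlt⟩ := PowerSeries.order_eq_nat.mp hm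
  have h1 : g₁.order = m := by
    rw [PowerSeries.order_eq_nat]
    refine ⟨?_, fun i hi => ?_⟩
    · rw [hcong m hmK]
      exact mul_ne_zero hu hcm
    · rw [hcong i (lt_trans hi hmK), hlt i hi, mul_zero]
  refine ⟨(hasUnitContent_iff_map_toZMod_ne_zero b₁).mpr (fun h0 => ?_), by rw [h1, hm]⟩
  have hz : g₁ = 0 := h0
  rw [hz, PowerSeries.order_zero] at h1
  exact (ENat.coe_ne_top m) h1.symm

/-- **Truncated congruence ⟹ `μ(b₁) = 0` and `λ(b₁) = λ(b₂)`** (`λ` of a unit-content element is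
the `T`-order of its reduction, `natCast_lam_eq_order_map_toZMod`).
[cite: GreenbergVatsal2000, §1 p. 10 (after (10))] [cite: Washington1997, §7.1] -/
theorem hasUnitContent_and_lam_eq_of_truncCongr {b₁ b₂ : IwasawaAlgebra p} {u : ZMod p}
    (hu : u ≠ 0) {K : ℕ}
    (hcong : ∀ j < K, PowerSeries.coeff j (PowerSeries.map (PadicInt.toZMod (p := p)) b₁) =
      u * PowerSeries.coeff j (PowerSeries.map (PadicInt.toZMod (p := p)) b₂))
    (hb₂ : HasUnitContent b₂) (hK : lam b₂ < K) :
    HasUnitContent b₁ ∧ lam b₁ = lam b₂ := by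
  have hK' : (PowerSeries.map (PadicInt.toZMod (p := p)) b₂).order < K := by
    rw [← natCast_lam_eq_order_map_toZMod hb₂]
    exact_mod_cast hK
  obtain ⟨h1, h2⟩ := hasUnitContent_and_order_eq_of_truncCongr hu hcong hb₂ hK'
  refine ⟨h1, ?_⟩
  have h := natCast_lam_eq_order_map_toZMod h1
  rw [h2, ← natCast_lam_eq_order_map_toZMod hb₂] at h
  exact_mod_cast h

/-- **With multipliers (the Σ₀-depleted form).** `P₁, P₂ ∈ Λ` of unit content with `T`-orders
`d₁, d₂` (intended: the Euler products `∏_{ℓ∈Σ₀} 𝒫_ℓ`, orders `Σ_{ℓ∈Σ₀} δ_{E_i}(ℓ)`; the unit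
content of `P₁` is not assumed — it follows); if
`b₁P₁ ≡ u·b₂P₂ (mod p, T^K)` coefficientwise, `u ≠ 0`, `b₂` has unit content and `λ(b₂) + d₂ < K`,
then `b₁` has unit content and `λ(b₁) + d₁ = λ(b₂) + d₂` — GV's display (9) on both sides of (10).
[cite: GreenbergVatsal2000, §1 (9)–(10) and p. 10] [cite: Washington1997, §7.1] -/
theorem hasUnitContent_and_lam_add_eq_of_truncCongr_mul {b₁ b₂ P₁ P₂ : IwasawaAlgebra p}
    {d₁ d₂ : ℕ} (hd₁ : (PowerSeries.map (PadicInt.toZMod (p := p)) P₁).order = d₁)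
    (hP₂ : HasUnitContent P₂)
    (hd₂ : (PowerSeries.map (PadicInt.toZMod (p := p)) P₂).order = d₂)
    {u : ZMod p} (hu : u ≠ 0) {K : ℕ}
    (hcong : ∀ j < K,
      PowerSeries.coeff j (PowerSeries.map (PadicInt.toZMod (p := p)) (b₁ * P₁)) =
        u * PowerSeries.coeff j (PowerSeries.map (PadicInt.toZMod (p := p)) (b₂ * P₂)))
    (hb₂ : HasUnitContent b₂) (hK : lam b₂ + d₂ < K) :
    HasUnitContent b₁ ∧ lam b₁ + d₁ = lam b₂ + d₂ := by
  have hb₂P : HasUnitContent (b₂ * P₂) := (hasUnitContent_mul_iff b₂ P₂).mpr ⟨hb₂, hP₂⟩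
  have hord₂ : (PowerSeries.map (PadicInt.toZMod (p := p)) (b₂ * P₂)).order =
      ((lam b₂ + d₂ : ℕ) : ℕ∞) := by
    rw [map_mul, PowerSeries.order_mul, ← natCast_lam_eq_order_map_toZMod hb₂, hd₂, Nat.cast_add]
  have hK' : (PowerSeries.map (PadicInt.toZMod (p := p)) (b₂ * P₂)).order < K := by
    rw [hord₂]
    exact_mod_cast hK
  obtain ⟨h1, h2⟩ := hasUnitContent_and_order_eq_of_truncCongr hu hcong hb₂P hK'
  have hb₁ : HasUnitContent b₁ := ((hasUnitContent_mul_iff b₁ P₁).mp h1).1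
  refine ⟨hb₁, ?_⟩
  have hord₁ : (PowerSeries.map (PadicInt.toZMod (p := p)) (b₁ * P₁)).order =
      ((lam b₁ + d₁ : ℕ) : ℕ∞) := by
    rw [map_mul, PowerSeries.order_mul, ← natCast_lam_eq_order_map_toZMod hb₁, hd₁, Nat.cast_add]
  rw [hord₁, hord₂] at h2
  exact_mod_cast h2

/-- A coefficient of `ι(G)` of norm `> p⁻¹` makes `G` of unit content (`μ(G) = 0`, `G ≠ 0`): the
reading of `AnalyticMuLE · p 0` on an integral model. [cite: GreenbergVatsal2000, p. 2, (2)] -/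
theorem hasUnitContent_of_iota_eq_of_lt_norm_coeff {G : IwasawaAlgebra p} {F : PowerSeries ℚ_[p]}
    (hG : iwasawaToPowerSeries p G = F) {k : ℕ}
    (hk : (p : ℝ) ^ (-(((0 : ℕ) : ℤ) + 1)) < ‖PowerSeries.coeff k F‖) : HasUnitContent G := by
  rw [← hG] at hk
  have hG0 : G ≠ 0 := by
    rintro rfl
    rw [map_zero, map_zero, norm_zero] at hk
    exact not_le.mpr hk (by positivity)
  exact hasUnitContent_of_mu_eq_zero hG0 (Nat.le_zero.mp (X1.MuPart.mu_le_of_lt_norm_coeff hk))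

end Algebra

/-! ## §2. The instance `P_i = ∏_{ℓ∈Σ₀} 𝒫_ℓ^{(E_i)}` (tree orientation of the Euler factors) -/

section EulerProducts

/-- **GV (10) truncated ⟹ (9) on both sides, with the tree's Euler products.** For `p` odd,
`Σ₀ ∌ p` finite, `b₁, b₂ ∈ Λ` (intended: integral models of `ϖ_i·L_p(E_i)`): if
`b₁·∏𝒫_ℓ^{(E₁)} ≡ u·b₂·∏𝒫_ℓ^{(E₂)} (mod p, T^K)` coefficientwise, `u ≠ 0`, `b₂` has unit content and
`λ(b₂) + Σ_{ℓ∈Σ₀} δ_{E₂}(ℓ) < K`, then `b₁` has unit content and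
`λ(b₁) + Σ_{ℓ∈Σ₀} δ_{E₁}(ℓ) = λ(b₂) + Σ_{ℓ∈Σ₀} δ_{E₂}(ℓ)`. (Orientation of `𝒫_ℓ`: see the module
docstring; §1 serves the other orientation verbatim.) [cite: GreenbergVatsal2000, §1 (9)–(10), §2 Prop. (2.4)] -/
theorem hasUnitContent_and_lam_add_sum_delta_eq_of_truncCongr (hp2 : p ≠ 2)
    (W₁ W₂ : WeierstrassCurve ℚ) (S₀ : Finset (HeightOneSpectrum (𝓞 ℚ)))
    (hS : ∀ v ∈ S₀, Rat.HeightOneSpectrum.natGenerator v ≠ p) {b₁ b₂ : IwasawaAlgebra p}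
    {u : ZMod p} (hu : u ≠ 0) {K : ℕ}
    (hcong : ∀ j < K,
      PowerSeries.coeff j (PowerSeries.map (PadicInt.toZMod (p := p))
          (b₁ * eulerFactorProduct W₁ p S₀)) =
        u * PowerSeries.coeff j (PowerSeries.map (PadicInt.toZMod (p := p))
          (b₂ * eulerFactorProduct W₂ p S₀)))
    (hb₂ : HasUnitContent b₂) (hK : lam b₂ + ∑ v ∈ S₀, delta W₂ p v < K) :
    HasUnitContent b₁ ∧
      lam b₁ + ∑ v ∈ S₀, delta W₁ p v = lam b₂ + ∑ v ∈ S₀, delta W₂ p v := by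
  obtain ⟨-, hd₁⟩ := order_map_toZMod_eulerFactorProduct W₁ S₀ hp2 hS
  obtain ⟨hP₂, hd₂⟩ := order_map_toZMod_eulerFactorProduct W₂ S₀ hp2 hS
  exact hasUnitContent_and_lam_add_eq_of_truncCongr_mul hd₁ hP₂ hd₂ hu hcong hb₂ hK

end EulerProducts

/-! ## §3. X2 ← X2: both analytic inputs of stubs 3 + 4 at `W` from a multiplicative twin -/

section X2X2

variable {W : WeierstrassCurve ℚ} [W.IsElliptic] [W.IsGloballyMinimal]
  {N : ℕ} [NeZero N] {f : CuspForm (Gamma0 N) 2} {ϖ : ℚ} {L : PowerSeries ℚ_[p]}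
  {W' : WeierstrassCurve ℚ} [W'.IsElliptic] [W'.IsGloballyMinimal]
  {N' : ℕ} [NeZero N'] {f' : CuspForm (Gamma0 N') 2} {ϖ' : ℚ} {L' : PowerSeries ℚ_[p]}

/-- **X2 ← X2: `μ_an(W) = 0` and `λ_an(W) = n` from a twin's certificate and ONE truncated
congruence.** Data: `(f, ϖ, L)` the datum of `X2.AnalyticMuLE` / `X2.AnalyticLambdaEq` at `(W, p)`
(odd multiplicative `p`) with an integral model `ι(G) = ϖ·L`; the same at the twin `(W′, p)` with
`ι(G′) = ϖ′·L′`; the twin's census certificate `X2.AnalyticMuLE W′ p 0 ∧ X2.AnalyticLambdaEq W′ p n′`;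
multipliers `P, P′` of `T`-orders `d, d′`, `P′` of unit content (the Σ₀-Euler products); the DISPLAYED
hypothesis `G·P ≡ u·G′·P′ (mod p, T^K)`, `u ≠ 0`, with `n′ + d′ < K`; and `n + d = n′ + d′`.
Conclusion: `X2.AnalyticMuLE W p 0 ∧ X2.AnalyticLambdaEq W p n`. No character, no `p`-adic `L`-value of
`W` is read: the target's analytic inputs come from the twin's. [cite: GreenbergVatsal2000, §1 (9)–(10), Thm. (1.4)]
[cite: Washington1997, §7.1] -/
theorem X2.analyticMuLE_zero_and_analyticLambdaEq_of_truncCongr (hf : IsNewformOf W f)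
    (hϖ : (ϖ : ℝ) * W.realPeriodRat = plusPeriod f)
    (hLs : W.HasSplitMultiplicativeReductionAtPrime p → IsSplitMultPAdicLFunctionOf f p L)
    (hLn : ¬ W.HasSplitMultiplicativeReductionAtPrime p → IsMultPAdicLFunctionOf f p (-1) L)
    {G : IwasawaAlgebra p} (hG : iwasawaToPowerSeries p G = PowerSeries.C ((ϖ : ℚ) : ℚ_[p]) * L)
    (hf' : IsNewformOf W' f') (hϖ' : (ϖ' : ℝ) * W'.realPeriodRat = plusPeriod f')
    (hLs' : W'.HasSplitMultiplicativeReductionAtPrime p → IsSplitMultPAdicLFunctionOf f' p L')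
    (hLn' : ¬ W'.HasSplitMultiplicativeReductionAtPrime p → IsMultPAdicLFunctionOf f' p (-1) L')
    {G' : IwasawaAlgebra p}
    (hG' : iwasawaToPowerSeries p G' = PowerSeries.C ((ϖ' : ℚ) : ℚ_[p]) * L')
    (hμ' : X2.AnalyticMuLE W' p 0) {n' : ℕ} (hlam' : X2.AnalyticLambdaEq W' p n')
    {P P' : IwasawaAlgebra p} {d d' : ℕ}
    (hd : (PowerSeries.map (PadicInt.toZMod (p := p)) P).order = d) (hP' : HasUnitContent P')
    (hd' : (PowerSeries.map (PadicInt.toZMod (p := p)) P').order = d')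
    {u : ZMod p} (hu : u ≠ 0) {K : ℕ}
    (hcong : ∀ j < K,
      PowerSeries.coeff j (PowerSeries.map (PadicInt.toZMod (p := p)) (G * P)) =
        u * PowerSeries.coeff j (PowerSeries.map (PadicInt.toZMod (p := p)) (G' * P')))
    (hK : n' + d' < K) {n : ℕ} (hn : n + d = n' + d') :
    X2.AnalyticMuLE W p 0 ∧ X2.AnalyticLambdaEq W p n := by
  -- the twin: `μ(G′) = 0`, `λ(G′) = n′`
  obtain ⟨k', hk'⟩ :=
    (EisensteinPrimesX2AnalyticLambdaCertificate.analyticMuLE_iff_of_datum hf' hϖ' hLs' hLn' 0).mp hμ'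
  have hG'u : HasUnitContent G' := hasUnitContent_of_iota_eq_of_lt_norm_coeff hG' hk'
  have hlamG' : lam G' = n' :=
    (EisensteinPrimesX2AnalyticLambdaCertificate.analyticLambdaEq_iff_of_datum hf' hϖ' hLs' hLn'
      n').mp hlam' G' hG'
  -- transfer
  obtain ⟨hGu, hadd⟩ := hasUnitContent_and_lam_add_eq_of_truncCongr_mul hd hP' hd' hu hcong
    hG'u (by rw [hlamG']; exact hK)
  have hlamG : lam G = n := by
    rw [hlamG'] at hadd
    omega
  -- read back in the X2 currency
  obtain ⟨k, hk⟩ := (hasUnitContent_iff_exists_norm_eq_one G).mp hGu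
  rw [EisensteinPrimesX2AnalyticLambdaCertificate.norm_coeff_eq_of_iota_eq hG] at hk
  refine ⟨EisensteinPrimesX2AnalyticLambdaCertificate.analyticMuLE_zero_of_norm_coeff_eq_one hf hϖ
      hLs hLn hk,
    (EisensteinPrimesX2AnalyticLambdaCertificate.analyticLambdaEq_iff_of_datum hf hϖ hLs hLn
      n).mpr fun G₁ hG₁ ↦ ?_⟩
  rw [iwasawaToPowerSeries_injective p (hG₁.trans hG.symm), hlamG]

end X2X2

/-! ## §4. X2 ← X1: route G's shape (target `p ‖ N`, twin good ordinary in `ClassX1`) -/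

section X2X1

variable {W : WeierstrassCurve ℚ} [W.IsElliptic] [W.IsGloballyMinimal]
  {N : ℕ} [NeZero N] {f : CuspForm (Gamma0 N) 2} {ϖ : ℚ} {L : PowerSeries ℚ_[p]}
  {W' : WeierstrassCurve ℚ} [W'.IsElliptic] [W'.IsGloballyMinimal] [NeZero (W'.conductorNorm ℤ)]
  {f' : CuspForm (Gamma0 (W'.conductorNorm ℤ)) 2} {ϖ' : ℚ}

/-- **X2 ← X1: `μ_an(W) = 0` and `λ_an(W) = n` at a multiplicative target from a GOOD ORDINARY
twin's certificate and ONE truncated congruence** — the analytic half of a route-G display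
(`hμ0`, `hlam` of `X2/RouteGSplitDisplay*`) as a consequence of the twin's `hμ0'`, `hlam'` and the
displayed congruence `G·P ≡ u·G′·P′ (mod p, T^K)` (`ι(G′) = ϖ′·L_p(f′, α)`, `α` the unit root).
[cite: GreenbergVatsal2000, §1 (9)–(10), Thm. (1.4)] [cite: Washington1997, §7.1] -/
theorem X2.analyticMuLE_zero_and_analyticLambdaEq_of_truncCongr_goodOrd (hf : IsNewformOf W f)
    (hϖ : (ϖ : ℝ) * W.realPeriodRat = plusPeriod f)
    (hLs : W.HasSplitMultiplicativeReductionAtPrime p → IsSplitMultPAdicLFunctionOf f p L)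
    (hLn : ¬ W.HasSplitMultiplicativeReductionAtPrime p → IsMultPAdicLFunctionOf f p (-1) L)
    {G : IwasawaAlgebra p} (hG : iwasawaToPowerSeries p G = PowerSeries.C ((ϖ : ℚ) : ℚ_[p]) * L)
    (hf' : IsNewformOf W' f') (hϖ' : (ϖ' : ℝ) * W'.realPeriodRat = plusPeriod f')
    {G' : IwasawaAlgebra p}
    (hG' : iwasawaToPowerSeries p G' =
      PowerSeries.C (ϖ' : ℚ_[p]) * padicLFunction f' (unitRoot W' p : ℚ_[p]))
    (hμ' : X1.MuPart.AnalyticMuLE W' p 0) {n' : ℕ}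
    (hlam' : X1.ParitySqueeze.AnalyticLambdaEq W' p n')
    {P P' : IwasawaAlgebra p} {d d' : ℕ}
    (hd : (PowerSeries.map (PadicInt.toZMod (p := p)) P).order = d) (hP' : HasUnitContent P')
    (hd' : (PowerSeries.map (PadicInt.toZMod (p := p)) P').order = d')
    {u : ZMod p} (hu : u ≠ 0) {K : ℕ}
    (hcong : ∀ j < K,
      PowerSeries.coeff j (PowerSeries.map (PadicInt.toZMod (p := p)) (G * P)) =
        u * PowerSeries.coeff j (PowerSeries.map (PadicInt.toZMod (p := p)) (G' * P')))
    (hK : n' + d' < K) {n : ℕ} (hn : n + d = n' + d') :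
    X2.AnalyticMuLE W p 0 ∧ X2.AnalyticLambdaEq W p n := by
  -- the twin (X1 currency): `μ(G′) = 0`, `λ(G′) = n′`
  obtain ⟨k', hk'⟩ :=
    (EisensteinPrimesX1AnalyticLambdaCertificate.analyticMuLE_iff_of_datum hf' hϖ' 0).mp hμ'
  have hG'u : HasUnitContent G' := hasUnitContent_of_iota_eq_of_lt_norm_coeff hG' hk'
  have hlamG' : lam G' = n' :=
    (EisensteinPrimesX1AnalyticLambdaCertificate.analyticLambdaEq_iff_of_datum hf' hϖ' n').mp hlam'
      G' hG'
  obtain ⟨hGu, hadd⟩ := hasUnitContent_and_lam_add_eq_of_truncCongr_mul hd hP' hd' hu hcong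
    hG'u (by rw [hlamG']; exact hK)
  have hlamG : lam G = n := by
    rw [hlamG'] at hadd
    omega
  obtain ⟨k, hk⟩ := (hasUnitContent_iff_exists_norm_eq_one G).mp hGu
  rw [EisensteinPrimesX2AnalyticLambdaCertificate.norm_coeff_eq_of_iota_eq hG] at hk
  refine ⟨EisensteinPrimesX2AnalyticLambdaCertificate.analyticMuLE_zero_of_norm_coeff_eq_one hf hϖ
      hLs hLn hk,
    (EisensteinPrimesX2AnalyticLambdaCertificate.analyticLambdaEq_iff_of_datum hf hϖ hLs hLn
      n).mpr fun G₁ hG₁ ↦ ?_⟩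
  rw [iwasawaToPowerSeries_injective p (hG₁.trans hG.symm), hlamG]

end X2X1

/-! ## §5. X1 ← X1: crux 5 currency (good ordinary target and twin) -/

section X1X1

variable {W : WeierstrassCurve ℚ} [W.IsElliptic] [W.IsGloballyMinimal] [NeZero (W.conductorNorm ℤ)]
  {f : CuspForm (Gamma0 (W.conductorNorm ℤ)) 2} {ϖ : ℚ}
  {W' : WeierstrassCurve ℚ} [W'.IsElliptic] [W'.IsGloballyMinimal] [NeZero (W'.conductorNorm ℤ)]
  {f' : CuspForm (Gamma0 (W'.conductorNorm ℤ)) 2} {ϖ' : ℚ}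

/-- **X1 ← X1: `X1.MuPart.AnalyticMuLE W p 0 ∧ X1.ParitySqueeze.AnalyticLambdaEq W p n` from a good
ordinary twin's certificate and ONE truncated congruence** (crux 5 `MazurMCOnX1RankZero`, row A3).
[cite: GreenbergVatsal2000, §1 (9)–(10), Thm. (1.4)] [cite: Washington1997, §7.1] -/
theorem X1.analyticMuLE_zero_and_analyticLambdaEq_of_truncCongr (hf : IsNewformOf W f)
    (hϖ : (ϖ : ℝ) * W.realPeriodRat = plusPeriod f) {G : IwasawaAlgebra p}
    (hG : iwasawaToPowerSeries p G =
      PowerSeries.C (ϖ : ℚ_[p]) * padicLFunction f (unitRoot W p : ℚ_[p]))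
    (hf' : IsNewformOf W' f') (hϖ' : (ϖ' : ℝ) * W'.realPeriodRat = plusPeriod f')
    {G' : IwasawaAlgebra p}
    (hG' : iwasawaToPowerSeries p G' =
      PowerSeries.C (ϖ' : ℚ_[p]) * padicLFunction f' (unitRoot W' p : ℚ_[p]))
    (hμ' : X1.MuPart.AnalyticMuLE W' p 0) {n' : ℕ}
    (hlam' : X1.ParitySqueeze.AnalyticLambdaEq W' p n')
    {P P' : IwasawaAlgebra p} {d d' : ℕ}
    (hd : (PowerSeries.map (PadicInt.toZMod (p := p)) P).order = d) (hP' : HasUnitContent P')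
    (hd' : (PowerSeries.map (PadicInt.toZMod (p := p)) P').order = d')
    {u : ZMod p} (hu : u ≠ 0) {K : ℕ}
    (hcong : ∀ j < K,
      PowerSeries.coeff j (PowerSeries.map (PadicInt.toZMod (p := p)) (G * P)) =
        u * PowerSeries.coeff j (PowerSeries.map (PadicInt.toZMod (p := p)) (G' * P')))
    (hK : n' + d' < K) {n : ℕ} (hn : n + d = n' + d') :
    X1.MuPart.AnalyticMuLE W p 0 ∧ X1.ParitySqueeze.AnalyticLambdaEq W p n := by
  obtain ⟨k', hk'⟩ :=
    (EisensteinPrimesX1AnalyticLambdaCertificate.analyticMuLE_iff_of_datum hf' hϖ' 0).mp hμ'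
  have hG'u : HasUnitContent G' := hasUnitContent_of_iota_eq_of_lt_norm_coeff hG' hk'
  have hlamG' : lam G' = n' :=
    (EisensteinPrimesX1AnalyticLambdaCertificate.analyticLambdaEq_iff_of_datum hf' hϖ' n').mp hlam'
      G' hG'
  obtain ⟨hGu, hadd⟩ := hasUnitContent_and_lam_add_eq_of_truncCongr_mul hd hP' hd' hu hcong
    hG'u (by rw [hlamG']; exact hK)
  have hlamG : lam G = n := by
    rw [hlamG'] at hadd
    omega
  obtain ⟨k, hk⟩ := (hasUnitContent_iff_exists_norm_eq_one G).mp hGu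
  rw [EisensteinPrimesX2AnalyticLambdaCertificate.norm_coeff_eq_of_iota_eq hG] at hk
  refine ⟨EisensteinPrimesX1AnalyticLambdaCertificate.analyticMuLE_zero_of_norm_coeff_eq_one hf hϖ hk,
    (EisensteinPrimesX1AnalyticLambdaCertificate.analyticLambdaEq_iff_of_datum hf hϖ n).mpr
      fun G₁ hG₁ ↦ ?_⟩
  rw [iwasawaToPowerSeries_injective p (hG₁.trans hG.symm), hlamG]

end X1X1

end Summit.BirchSwinnertonDyer.BirchSwinnertonDyer.Theorems.EisensteinPrimesAnalyticLambdaCongruenceTransfer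

end
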